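import Mathlib
import HarnessLib

/-!
# B3loc reduces to level one — complementary cyclic lines in a free rank-2 `ℤ/p^k`-module (-imc g30, 2026-08-31)

Planner support (LENS IMC seat, planner-of-record bsd-f1-sign2) for the hand **B3loc** of crux
`SupersingularRankZeroAtTwo` (stmt-BirchSwinnertonDyer-19097), LEAD ss-1 GEN 21 `HAND-TARGETS-CDC-4.md` @a34de69cf2e66a0c:
«for `J ≥ J₃` the transported ♭-line `L_J(ψ)` and `Kum_J(W₂)_v` are complementary in `H¹(ℚ_v, W₂[2^J])`: `⊓ = ⊥ ∧ ⊔ = ⊤`».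

**The algebra behind the bus remark (bsd-2adic INBOX 2026-08-31T08:2xZ).**  When `H¹(ℚ_v, W₂[2^J]) ≅ (ℤ/2^J)²` is free of
rank two (local Euler characteristic + `W₂(ℚ_v)[2] = 0`) and both lines are cyclic of order `2^J`, complementarity at level `J` is
EQUIVALENT to independence modulo `2`, i.e. to the depth-one statement «the two lines have distinct images in
`H¹ ⊗ 𝔽₂ ≅ 𝔽₂²`» (Nakayama).  This file proves the underlying finite-group lemma for any prime `p` and `k ≥ 1`:

* `complement_iff_independent_mod_p` : for `M ≃+ (ℤ/p^k)²`, `ℓ κ : M` of additive order `p^k`,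
  `(ℤℓ ⊓ ℤκ = ⊥ ∧ ℤℓ ⊔ ℤκ = ⊤) ↔ (∀ a b : ℤ, (∃ m, a•ℓ + b•κ = p•m) → p ∣ a ∧ p ∣ b)`.

No elliptic-curve input; sorry-free; imports `Mathlib` only.  The hand keeps the burden of (a) the frame
`H¹(ℚ_v, W₂[2^J]) ≃+ (ℤ/2^J)²`, (b) cyclicity of full order of the two lines, (c) identifying «independent mod 2» with distinctness
of the level-one lines in `H¹(ℚ_v, W₂[2])` (tower compatibility of `L_J(ψ)`).
-/

set_option autoImplicit false
set_option linter.dupNamespace false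

namespace Summit.BirchSwinnertonDyer.BirchSwinnertonDyer.Cruxes.SupersingularRankZeroAtTwo.B3locLevelOne

open AddSubgroup

/-- In `ℤ/p^k`: if `p^j · x = 0` with `j ≤ k` then `x ∈ p^(k-j) · (ℤ/p^k)`. -/
theorem zmod_exists_eq_pow_mul_of_pow_mul_eq_zero (p k j : ℕ) (hp : p.Prime) (hj : j ≤ k) (x : ZMod (p ^ k))
    (hx : (p : ZMod (p ^ k)) ^ j * x = 0) : ∃ y : ZMod (p ^ k), x = (p : ZMod (p ^ k)) ^ (k - j) * y := by
  haveI : NeZero (p ^ k) := ⟨pow_ne_zero _ hp.ne_zero⟩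
  have hx' : ((p ^ j * x.val : ℕ) : ZMod (p ^ k)) = 0 := by
    rw [Nat.cast_mul, Nat.cast_pow, ZMod.natCast_zmod_val, hx]
  rw [ZMod.natCast_eq_zero_iff] at hx'
  have hsplit : p ^ k = p ^ j * p ^ (k - j) := by rw [← pow_add, Nat.add_sub_cancel' hj]
  have hx'' : p ^ j * p ^ (k - j) ∣ p ^ j * x.val := by rw [← hsplit]; exact hx'
  obtain ⟨c, hc⟩ := Nat.dvd_of_mul_dvd_mul_left (pow_pos hp.pos j) hx''
  refine ⟨(c : ZMod (p ^ k)), ?_⟩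
  rw [← ZMod.natCast_zmod_val x, hc, Nat.cast_mul, Nat.cast_pow]

variable {M : Type*} [AddCommGroup M]

/-- Frame lemma: in `M ≃+ (ℤ/p^k)²`, `p^j`-torsion lies in `p^(k-j) M` (`j ≤ k`). -/
theorem exists_eq_pow_smul_of_pow_smul_eq_zero (p k j : ℕ) (hp : p.Prime) (hj : j ≤ k)
    (e : M ≃+ (Fin 2 → ZMod (p ^ k))) (x : M) (hx : (p ^ j : ℕ) • x = 0) :
    ∃ y : M, x = (p ^ (k - j) : ℕ) • y := by
  have hcoord : ∀ i : Fin 2, (p : ZMod (p ^ k)) ^ j * e x i = 0 := by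
    intro i
    have h := congrArg (fun v ↦ v i) (map_nsmul e (p ^ j) x)
    simp only [hx, map_zero, Pi.zero_apply, Pi.smul_apply, nsmul_eq_mul, Nat.cast_pow] at h
    exact h.symm
  choose y hy using fun i ↦ zmod_exists_eq_pow_mul_of_pow_mul_eq_zero p k j hp hj (e x i) (hcoord i)
  refine ⟨e.symm (fun i ↦ y i), e.injective ?_⟩
  rw [map_nsmul, e.apply_symm_apply]
  funext i
  rw [Pi.smul_apply, nsmul_eq_mul, Nat.cast_pow, hy i]

/-- `#M = p^(2k)` for `M ≃+ (ℤ/p^k)²`. -/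
theorem natCard_eq_of_frame (p k : ℕ) (e : M ≃+ (Fin 2 → ZMod (p ^ k))) (hp : p.Prime) :
    Nat.card M = p ^ k * p ^ k := by
  haveI : NeZero (p ^ k) := ⟨pow_ne_zero _ hp.ne_zero⟩
  rw [Nat.card_congr e.toEquiv, Nat.card_eq_fintype_card, Fintype.card_fun, ZMod.card, Fintype.card_fin, pow_two]

/-- **Relations lemma.** Independence mod `p` forces every relation `a•ℓ + b•κ = 0` to be trivial mod `p^k`. -/
theorem dvd_of_rel_of_independent (p k : ℕ) (hp : p.Prime)
    (e : M ≃+ (Fin 2 → ZMod (p ^ k))) (ℓ κ : M)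
    (hind : ∀ a b : ℤ, (∃ m : M, a • ℓ + b • κ = (p : ℤ) • m) → (p : ℤ) ∣ a ∧ (p : ℤ) ∣ b)
    (a b : ℤ) (hrel : a • ℓ + b • κ = 0) : ((p ^ k : ℕ) : ℤ) ∣ a ∧ ((p ^ k : ℕ) : ℤ) ∣ b := by
  -- `Q j : p^j ∣ a ∧ p^j ∣ b` for all `j ≤ k`, by induction on `j`
  suffices hQ : ∀ j : ℕ, j ≤ k → ((p ^ j : ℕ) : ℤ) ∣ a ∧ ((p ^ j : ℕ) : ℤ) ∣ b from hQ k le_rfl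
  intro j
  induction j with
  | zero => intro _; simp
  | succ j ih =>
    intro hjk
    obtain ⟨⟨a', ha'⟩, ⟨b', hb'⟩⟩ := ih (Nat.le_of_succ_le hjk)
    -- `x := a'ℓ + b'κ` is killed by `p^j`
    have hx : (p ^ j : ℕ) • (a' • ℓ + b' • κ) = 0 := by
      rw [← natCast_zsmul, smul_add, smul_smul, smul_smul, ← ha', ← hb', hrel]
    obtain ⟨y, hy⟩ := exists_eq_pow_smul_of_pow_smul_eq_zero p k j hp (Nat.le_of_succ_le hjk) e _ hx
    -- `p^(k-j) = p * p^r` with `r = k-j-1`, since `j < k`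
    obtain ⟨r, hr⟩ : ∃ r : ℕ, k - j = r + 1 := ⟨k - j - 1, by omega⟩
    have hpm : ∃ m : M, a' • ℓ + b' • κ = (p : ℤ) • m := by
      refine ⟨(p ^ r : ℕ) • y, ?_⟩
      rw [hy, ← natCast_zsmul y (p ^ (k - j)), ← natCast_zsmul y (p ^ r), smul_smul, hr, pow_succ,
        Nat.cast_mul, mul_comm]
    obtain ⟨⟨a'', ha''⟩, ⟨b'', hb''⟩⟩ := hind a' b' hpm
    refine ⟨⟨a'', ?_⟩, ⟨b'', ?_⟩⟩
    · rw [ha', ha'', pow_succ, Nat.cast_mul, mul_assoc]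
    · rw [hb', hb'', pow_succ, Nat.cast_mul, mul_assoc]

/-- ★ **Complementary cyclic lines ⟺ independence mod `p`.**  For `M ≃+ (ℤ/p^k)²` (`k ≥ 1`) and `ℓ, κ ∈ M` of additive order
`p^k`, the cyclic subgroups `ℤℓ`, `ℤκ` are complementary (`⊓ = ⊥`, `⊔ = ⊤`) iff `ℓ, κ` are independent modulo `p`
(every `a•ℓ + b•κ ∈ pM` has `p ∣ a` and `p ∣ b`), i.e. iff their images in `M/pM ≅ 𝔽_p²` are distinct lines.
Application (B3loc of crux 19097, twist side at `v ∣ 2`, `p = 2`, `k = J`): complementarity of the transported ♭-line and the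
Kummer line at every level `J ≥ J₃` is the single depth-one statement at level `1`. -/
theorem complement_iff_independent_mod_p (p k : ℕ) (hp : p.Prime) (hk : 1 ≤ k)
    (e : M ≃+ (Fin 2 → ZMod (p ^ k))) (ℓ κ : M) (hℓ : addOrderOf ℓ = p ^ k) (hκ : addOrderOf κ = p ^ k) :
    (zmultiples ℓ ⊓ zmultiples κ = ⊥ ∧ zmultiples ℓ ⊔ zmultiples κ = ⊤) ↔
      (∀ a b : ℤ, (∃ m : M, a • ℓ + b • κ = (p : ℤ) • m) → (p : ℤ) ∣ a ∧ (p : ℤ) ∣ b) := by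
  haveI : NeZero (p ^ k) := ⟨pow_ne_zero _ hp.ne_zero⟩
  have hp1 : 1 < p := hp.one_lt
  constructor
  · ------------------------------------------------------------------
    -- (⇒) complement ⟹ independent mod p
    ------------------------------------------------------------------
    rintro ⟨hinf, hsup⟩ a b ⟨m, hm⟩
    -- write `m = a₁ℓ + b₁κ`
    have hm_mem : m ∈ zmultiples ℓ ⊔ zmultiples κ := by rw [hsup]; exact mem_top m
    obtain ⟨y, hy, z, hz, hyz⟩ := mem_sup.mp hm_mem
    obtain ⟨a₁, rfl⟩ := mem_zmultiples_iff.mp hy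
    obtain ⟨b₁, rfl⟩ := mem_zmultiples_iff.mp hz
    -- `(a - p a₁)ℓ = -(b - p b₁)κ ∈ ℤℓ ∩ ℤκ = 0`
    have h1 : a • ℓ + b • κ = ((p : ℤ) * a₁) • ℓ + ((p : ℤ) * b₁) • κ := by
      rw [hm, ← hyz, smul_add, mul_smul, mul_smul]
    have hrel : (a - p * a₁) • ℓ + (b - p * b₁) • κ = 0 := by
      rw [sub_smul, sub_smul]
      calc a • ℓ - ((p : ℤ) * a₁) • ℓ + (b • κ - ((p : ℤ) * b₁) • κ)
          = (a • ℓ + b • κ) - (((p : ℤ) * a₁) • ℓ + ((p : ℤ) * b₁) • κ) := by abel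
        _ = 0 := by rw [h1, sub_self]
    have hLmem : (a - p * a₁) • ℓ ∈ zmultiples ℓ ⊓ zmultiples κ := by
      refine mem_inf.mpr ⟨mem_zmultiples_iff.mpr ⟨_, rfl⟩, mem_zmultiples_iff.mpr ⟨-(b - p * b₁), ?_⟩⟩
      rw [neg_smul]; exact neg_eq_of_add_eq_zero_left hrel
    rw [hinf, mem_bot] at hLmem
    have hKmem : (b - p * b₁) • κ = 0 := by rwa [hLmem, zero_add] at hrel
    have hda : ((p ^ k : ℕ) : ℤ) ∣ (a - p * a₁) := by
      rw [← hℓ]; exact (addOrderOf_dvd_iff_zsmul_eq_zero).mpr hLmem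
    have hdb : ((p ^ k : ℕ) : ℤ) ∣ (b - p * b₁) := by
      rw [← hκ]; exact (addOrderOf_dvd_iff_zsmul_eq_zero).mpr hKmem
    have hpk : (p : ℤ) ∣ ((p ^ k : ℕ) : ℤ) := by
      rw [Nat.cast_pow]; exact dvd_pow_self _ (by omega)
    refine ⟨?_, ?_⟩
    · have h := (hpk.trans hda)
      have h2 : (p : ℤ) ∣ p * a₁ := dvd_mul_right _ _
      simpa using (dvd_add h h2)
    · have h := (hpk.trans hdb)
      have h2 : (p : ℤ) ∣ p * b₁ := dvd_mul_right _ _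
      simpa using (dvd_add h h2)
  · ------------------------------------------------------------------
    -- (⇐) independent mod p ⟹ complement
    ------------------------------------------------------------------
    intro hind
    have hrel := dvd_of_rel_of_independent p k hp e ℓ κ hind
    refine ⟨?_, ?_⟩
    · -- `⊓ = ⊥`
      rw [eq_bot_iff]
      intro x hx
      obtain ⟨hxL, hxK⟩ := mem_inf.mp hx
      obtain ⟨a, rfl⟩ := mem_zmultiples_iff.mp hxL
      obtain ⟨b, hb⟩ := mem_zmultiples_iff.mp hxK
      have h0 : a • ℓ + (-b) • κ = 0 := by rw [neg_smul, hb, add_neg_cancel]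
      obtain ⟨ha, _⟩ := hrel a (-b) h0
      rw [mem_bot]
      have ha' : (addOrderOf ℓ : ℤ) ∣ a := by rw [hℓ]; exact ha
      exact (addOrderOf_dvd_iff_zsmul_eq_zero).mp ha'
    · -- `⊔ = ⊤` by counting: `(ā, b̄) ↦ aℓ + bκ` is injective on `(ℤ/p^k)²`, a set of size `#M`
      set g : ZMod (p ^ k) × ZMod (p ^ k) → M := fun v ↦ (v.1.val : ℤ) • ℓ + (v.2.val : ℤ) • κ with hg
      have hginj : Function.Injective g := by
        intro v w hvw
        have h0 : ((v.1.val : ℤ) - w.1.val) • ℓ + ((v.2.val : ℤ) - w.2.val) • κ = 0 := by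
          simp only [hg] at hvw
          rw [sub_smul, sub_smul]
          have := hvw
          calc (v.1.val : ℤ) • ℓ - (w.1.val : ℤ) • ℓ + ((v.2.val : ℤ) • κ - (w.2.val : ℤ) • κ)
              = ((v.1.val : ℤ) • ℓ + (v.2.val : ℤ) • κ) - ((w.1.val : ℤ) • ℓ + (w.2.val : ℤ) • κ) := by abel
            _ = 0 := by rw [this, sub_self]
        obtain ⟨h1, h2⟩ := hrel _ _ h0
        have key : ∀ s t : ZMod (p ^ k), ((p ^ k : ℕ) : ℤ) ∣ ((s.val : ℤ) - t.val) → s = t := by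
          intro s t hst
          have h : ((s.val : ℤ) : ZMod (p ^ k)) - ((t.val : ℤ) : ZMod (p ^ k)) = 0 := by
            rw [← Int.cast_sub, ZMod.intCast_zmod_eq_zero_iff_dvd]; exact_mod_cast hst
          rwa [Int.cast_natCast, Int.cast_natCast, ZMod.natCast_zmod_val, ZMod.natCast_zmod_val, sub_eq_zero] at h
        exact Prod.ext (key _ _ h1) (key _ _ h2)
      haveI : Finite M := Finite.of_equiv _ e.toEquiv.symm
      have hcard : Nat.card (ZMod (p ^ k) × ZMod (p ^ k)) = Nat.card M := by
        rw [natCard_eq_of_frame p k e hp, Nat.card_prod, Nat.card_zmod]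
      have hgsurj : Function.Surjective g :=
        (Function.Injective.bijective_of_nat_card_le hginj hcard.ge).2
      rw [eq_top_iff]
      intro x _
      obtain ⟨v, rfl⟩ := hgsurj x
      exact mem_sup.mpr ⟨_, mem_zmultiples_iff.mpr ⟨_, rfl⟩, _, mem_zmultiples_iff.mpr ⟨_, rfl⟩, rfl⟩

/-- Frame exponent: `p^k · M = 0` for `M ≃+ (ℤ/p^k)²`. -/
theorem pow_smul_eq_zero_of_frame (p k : ℕ) (e : M ≃+ (Fin 2 → ZMod (p ^ k))) (m : M) :
    (p ^ k : ℕ) • m = 0 := by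
  apply e.injective
  rw [map_nsmul, map_zero]
  funext i
  rw [Pi.smul_apply, Pi.zero_apply, nsmul_eq_mul, ZMod.natCast_self, zero_mul]

/-- An element of full order `p^k` (`k ≥ 1`) is not in `pM`. -/
theorem not_exists_eq_smul_of_addOrderOf (p k : ℕ) (hp : p.Prime) (hk : 1 ≤ k)
    (e : M ≃+ (Fin 2 → ZMod (p ^ k))) (ℓ : M) (hℓ : addOrderOf ℓ = p ^ k) :
    ¬ ∃ m : M, ℓ = (p : ℤ) • m := by
  rintro ⟨m, hm⟩
  have h0 : (p ^ (k - 1) : ℕ) • ℓ = 0 := by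
    rw [hm, ← natCast_zsmul, smul_smul, ← Nat.cast_mul, natCast_zsmul,
      ← pow_succ, Nat.sub_add_cancel hk, pow_smul_eq_zero_of_frame p k e m]
  have hdvd : p ^ k ∣ p ^ (k - 1) := by rw [← hℓ]; exact addOrderOf_dvd_of_nsmul_eq_zero h0
  rw [Nat.pow_dvd_pow_iff_le_right hp.one_lt] at hdvd
  omega

/-- ★★ **`p = 2`: complementary ⟺ the two lines differ mod `2` — ONE bit.**  For `M ≃+ (ℤ/2^k)²` (`k ≥ 1`) and `ℓ, κ` of
order `2^k`: `ℤℓ ⊓ ℤκ = ⊥ ∧ ℤℓ ⊔ ℤκ = ⊤ ↔ κ - ℓ ∉ 2M`.  (In `M/2M ≅ 𝔽₂²` there are exactly three lines; `ℓ̄, κ̄ ≠ 0`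
automatically, so complementarity is the single condition `κ̄ ≠ ℓ̄`.)  For B3loc: at every level `J ≥ J₃`, «`L_J(ψ)` and
`Kum_J(W₂)_v` complementary» ⟺ «generators differ mod `2`» ⟺ (tower compatibility) «`L_1(ψ) ≠ Kum_1(W₂)_v` in
`H¹(ℚ_v, W₂[2]) ≅ 𝔽₂²`». -/
theorem complement_iff_sub_notMem_two (k : ℕ) (hk : 1 ≤ k) (e : M ≃+ (Fin 2 → ZMod (2 ^ k))) (ℓ κ : M)
    (hℓ : addOrderOf ℓ = 2 ^ k) (hκ : addOrderOf κ = 2 ^ k) :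
    (zmultiples ℓ ⊓ zmultiples κ = ⊥ ∧ zmultiples ℓ ⊔ zmultiples κ = ⊤) ↔ ¬ ∃ m : M, κ - ℓ = (2 : ℤ) • m := by
  have key := complement_iff_independent_mod_p 2 k Nat.prime_two hk e ℓ κ hℓ hκ
  have hℓ2 := not_exists_eq_smul_of_addOrderOf 2 k Nat.prime_two hk e ℓ hℓ
  have hκ2 := not_exists_eq_smul_of_addOrderOf 2 k Nat.prime_two hk e κ hκ
  simp only [Nat.cast_ofNat] at key hℓ2 hκ2
  rw [key]
  constructor
  · rintro hind ⟨m, hm⟩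
    have h := hind (-1) 1 ⟨m, by rw [neg_smul, one_smul, one_smul, neg_add_eq_sub, hm]⟩
    omega
  · rintro hnot a b ⟨m, hm⟩
    obtain ⟨a', ha | ha⟩ : ∃ a', a = 2 * a' ∨ a = 2 * a' + 1 := ⟨a / 2, by omega⟩ <;>
      obtain ⟨b', hb | hb⟩ : ∃ b', b = 2 * b' ∨ b = 2 * b' + 1 := ⟨b / 2, by omega⟩
    · exact ⟨⟨a', ha⟩, ⟨b', hb⟩⟩
    · -- a even, b odd ⟹ κ ∈ 2M
      exfalso; refine hκ2 ⟨m - a' • ℓ - b' • κ, ?_⟩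
      have h2m : (2 : ℤ) • m = (2 * a') • ℓ + (2 * b' + 1) • κ := by rw [← ha, ← hb, hm]
      rw [smul_sub, smul_sub, h2m]; module
    · -- a odd, b even ⟹ ℓ ∈ 2M
      exfalso; refine hℓ2 ⟨m - a' • ℓ - b' • κ, ?_⟩
      have h2m : (2 : ℤ) • m = (2 * a' + 1) • ℓ + (2 * b') • κ := by rw [← ha, ← hb, hm]
      rw [smul_sub, smul_sub, h2m]; module
    · -- both odd ⟹ κ - ℓ ∈ 2M
      exfalso; refine hnot ⟨m - a' • ℓ - b' • κ - ℓ, ?_⟩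
      have h2m : (2 : ℤ) • m = (2 * a' + 1) • ℓ + (2 * b' + 1) • κ := by rw [← ha, ← hb, hm]
      rw [smul_sub, smul_sub, smul_sub, h2m]; module

end Summit.BirchSwinnertonDyer.BirchSwinnertonDyer.Cruxes.SupersingularRankZeroAtTwo.B3locLevelOne
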